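import Literature.Computability.AlgebraicComplexity.NewtonPolygonTau
import Literature.Computability.AlgebraicComplexity.TavenasVnWitness
import Literature.Computability.AlgebraicComplexity.PermanentBooleanSum
import HarnessLib

/-!
# KPTT 2015, Theorem 1 (weak form): the Newton-polygon τ-conjecture implies that `PER ∉ VP_ℂ` — the transfer theorem, discharged

Discharge (D-0014) of the named fact `Literature.Computability.AlgebraicComplexity.KPTT.theorem1`
(`NewtonPolygonTau.lean`; P. Koiran, N. Portier, S. Tavenas, S. Thomassé, *A τ-conjecture for
Newton polygons*, Found. Comput. Math. 15 (2015) 185–197, Thm. 1 with the "for instance" bound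
`2^{O(m)} (kt)^{O(1)}`): `KPTT.theorem1_holds`.

We follow the printed proof (§3 of the paper) step by step:

1. *The witness.* Print: `f_n = ∑_{i<2^n} X^i Y^{i²}`, whose Newton polygon has `2^n` edges.
   Here (the only deviation): `F_n = ∑_{i<2^n} X^i Y^{2i(2^n-1-i)}` (`kpttPoly`), whose `2^n`
   support points lie on a strictly concave parabola and are therefore all vertices of
   `Newt(F_n)` (`newtonVertexCount_kpttPoly`, via one strictly separating linear functional per
   vertex, `mem_extremePoints_convexHull_of_linear`). The reason for the variant is step 2: its
   multilinear bit polynomial is the tree's `TavenasVn.hV` (Tavenas 2014, Lemme 3.36), whose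
   Valiant-criterion expression is already written down in `TavenasVnWitness.lean`.
2. *`h_n ∈ VNP` by Valiant's criterion; `PER` is `VNP`-complete.* Print: "The coefficients
   `a(n,α,β)` can be computed in time polynomial in `n`. By Valiant's criterion … `(h_n) ∈ VNP`.
   Since the permanent is `VNP`-complete …". Here: `h_n = hV ℂ n` is the Boolean sum of the
   explicit polynomial-size expression `witnessE ℂ n` (`TavenasVn.bsum_eval_witnessE`), hence by
   BCS Thm. (21.27) and Thm. (21.29) over `ℂ` (both PROVED in the tree) a projection of
   `PER_{q(n)}` with `q` p-bounded (`exists_isProjection_hV_perPoly_complex`).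
3. *Reduction to depth four* (Thm. 2 of the paper = Koiran 2012 / Tavenas 2013). Here the tree's
   proved structural theorem `DepthReduction.SLP.exists_sum_prod` (`GateQuotients.lean`), used
   exactly as in the tree's proof of Tavenas' Prop. 3.21 (`exists_sps_of_isProjection_perPoly`,
   `RealTauConjectureViaVn.lean`), with the bivariate substitution `x_j ↦ X^{2^j}`, `y_l ↦ Y^{2^l}`
   (display (plugin) of the paper, `xySubst`) in place of `x_j ↦ X^{2^j}`, `z_l ↦ 2^{2^l}`:
   `exists_sps_xy_of_isProjection_perPoly`. If `PER ∈ VP_ℂ` then `L(h_n) ≤ L(PER_{q(n)}) = n^{O(1)}`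
   (projections are free), so `F_n = ∑_{i≤k} ∏_{j≤m} g_{ij}` with `k, t ≤ (n+2)^{C(⌊√(2n+3)⌋+1)}`,
   `m ≤ C(⌊√(2n+3)⌋+1)`, the `g_{ij}` `t`-sparse (monomial substitutions do not increase the
   number of monomials, `card_support_aeval_le_of_isMvTerm`).
4. *Conclusion.* The weak bound gives `2^n = #vert Newt(F_n) ≤ 2^{am} (kt+2)^b ≤ (n+2)^{K(⌊√(2n+3)⌋+4)}`,
   false for suitable `n` (`exists_pow_sqrt_lt_two_pow`, `RealTauConjectureProofs.lean`).

No new named fact is introduced; everything below is proved.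

## References

* P. Koiran, N. Portier, S. Tavenas, S. Thomassé, *A τ-conjecture for Newton polygons*, Found.
  Comput. Math. 15 (2015) 185–197 (arXiv:1308.2286): Thm. 1 and its proof, §3 (Thm. 2, displays
  (hardpoly), (plugin)) [KoiranPortierTavenasThomasse2015].
* S. Tavenas, *Bornes inférieures et supérieures dans les circuits arithmétiques*, PhD thesis,
  ENS Lyon 2014, Lemme 3.36, Cor. 3.37, Prop. 3.21.
* P. Bürgisser, M. Clausen, M. A. Shokrollahi, *Algebraic Complexity Theory*, Springer 1997,
  Thm. (21.27), Thm. (21.29).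
-/

noncomputable section

open MvPolynomial

universe u v w

namespace Literature.Computability.AlgebraicComplexity

open ArithCircuit Complexity

/-! ### Monomials under monomial substitutions (multivariate targets) -/

section MvTerms

variable {R : Type u} [CommSemiring R] {σ : Type v} {τ : Type w}

/-- A multivariate polynomial is a *term* if it is `monomial m c`. [folklore] -/
def IsMvTerm (p : MvPolynomial τ R) : Prop :=
  ∃ (m : τ →₀ ℕ) (c : R), p = monomial m c

/-- Constants are terms. [folklore] -/
theorem isMvTerm_C (c : R) : IsMvTerm (C c : MvPolynomial τ R) := ⟨0, c, by rw [C_apply]⟩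

/-- `1` is a term. [folklore] -/
theorem isMvTerm_one : IsMvTerm (1 : MvPolynomial τ R) := ⟨0, 1, by rw [← C_1, C_apply]⟩

/-- Powers of variables are terms. [folklore] -/
theorem isMvTerm_X_pow (i : τ) (e : ℕ) : IsMvTerm ((X i : MvPolynomial τ R) ^ e) :=
  ⟨Finsupp.single i e, 1, X_pow_eq_monomial⟩

/-- Terms are closed under products. [folklore] -/
theorem IsMvTerm.mul {p q : MvPolynomial τ R} (hp : IsMvTerm p) (hq : IsMvTerm q) : IsMvTerm (p * q) := by
  obtain ⟨m, c, rfl⟩ := hp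
  obtain ⟨m', c', rfl⟩ := hq
  exact ⟨m + m', c * c', monomial_mul⟩

/-- Terms are closed under powers. [folklore] -/
theorem IsMvTerm.pow {p : MvPolynomial τ R} (hp : IsMvTerm p) (n : ℕ) : IsMvTerm (p ^ n) := by
  induction n with
  | zero => rw [pow_zero]; exact isMvTerm_one
  | succ n ih => rw [pow_succ]; exact ih.mul hp

/-- Terms are closed under finite products. [folklore] -/
theorem IsMvTerm.finset_prod {ι : Type*} (s : Finset ι) (f : ι → MvPolynomial τ R)
    (h : ∀ i ∈ s, IsMvTerm (f i)) : IsMvTerm (∏ i ∈ s, f i) := by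
  classical
  induction s using Finset.induction_on with
  | empty => rw [Finset.prod_empty]; exact isMvTerm_one
  | insert a s ha ih =>
    rw [Finset.prod_insert ha]
    exact (h a (Finset.mem_insert_self a s)).mul (ih fun i hi => h i (Finset.mem_insert_of_mem hi))

/-- A term has at most one monomial. [folklore] -/
theorem IsMvTerm.card_support_le {p : MvPolynomial τ R} (hp : IsMvTerm p) : p.support.card ≤ 1 := by
  classical
  obtain ⟨m, c, rfl⟩ := hp
  rw [support_monomial]
  split_ifs <;> simp

/-- A substitution of terms for the variables maps monomials to terms. [folklore] -/
theorem isMvTerm_aeval_monomial {v : σ → MvPolynomial τ R} (hv : ∀ x, IsMvTerm (v x)) (m : σ →₀ ℕ) (c : R) :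
    IsMvTerm (MvPolynomial.aeval v (MvPolynomial.monomial m c)) := by
  rw [MvPolynomial.aeval_monomial, Finsupp.prod]
  refine IsMvTerm.mul ?_ (IsMvTerm.finset_prod _ _ fun x _ => (hv x).pow _)
  rw [MvPolynomial.algebraMap_eq]
  exact isMvTerm_C c

/-- **Monomial substitutions do not increase the number of monomials** (multivariate targets):
if every `v x` is a term then `aeval v p` has at most as many monomials as `p` (used in §3 of
the paper: plugging powers of `X`, `Y` into a `t`-sparse polynomial gives a `t`-sparse
polynomial). [cite: KoiranPortierTavenasThomasse2015, §3 (proof of Thm. 1)] -/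
theorem card_support_aeval_le_of_isMvTerm {v : σ → MvPolynomial τ R} (hv : ∀ x, IsMvTerm (v x))
    (p : MvPolynomial σ R) : (MvPolynomial.aeval v p).support.card ≤ p.support.card := by
  classical
  have key : ∀ s : Finset (σ →₀ ℕ),
      (MvPolynomial.aeval v (∑ m ∈ s, MvPolynomial.monomial m (p.coeff m))).support.card ≤ s.card := by
    intro s
    induction s using Finset.induction_on with
    | empty => simp
    | insert a s ha ih =>
      rw [Finset.sum_insert ha, map_add, Finset.card_insert_of_notMem ha]
      calc (MvPolynomial.aeval v (MvPolynomial.monomial a (p.coeff a)) +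
              MvPolynomial.aeval v (∑ m ∈ s, MvPolynomial.monomial m (p.coeff m))).support.card
          ≤ ((MvPolynomial.aeval v (MvPolynomial.monomial a (p.coeff a))).support ∪
              (MvPolynomial.aeval v (∑ m ∈ s, MvPolynomial.monomial m (p.coeff m))).support).card :=
            Finset.card_le_card MvPolynomial.support_add
        _ ≤ (MvPolynomial.aeval v (MvPolynomial.monomial a (p.coeff a))).support.card +
              (MvPolynomial.aeval v (∑ m ∈ s, MvPolynomial.monomial m (p.coeff m))).support.card :=
            Finset.card_union_le _ _
        _ ≤ 1 + s.card := Nat.add_le_add (isMvTerm_aeval_monomial hv a _).card_support_le ih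
        _ = s.card + 1 := Nat.add_comm _ _
  conv_lhs => rw [p.as_sum]
  exact key p.support

end MvTerms

/-! ### The substitution (plugin): `x_j ↦ X^{2^j}`, `y_l ↦ Y^{2^l}` -/

/-- KPTT's substitution (display (plugin), §3): `x_j ↦ X^{2^j}` (`j < d`) and `y_l ↦ Y^{2^l}`
(`l < r`), into `ℂ[X, Y] = MvPolynomial (Fin 2) ℂ` (`X = X 0`, `Y = X 1`). [cite: KoiranPortierTavenasThomasse2015, §3 (plugin)] -/
def xySubst (d r : ℕ) : Fin d ⊕ Fin r → MvPolynomial (Fin 2) ℂ :=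
  Sum.elim (fun j => X 0 ^ 2 ^ (j : ℕ)) (fun l => X 1 ^ 2 ^ (l : ℕ))

/-- Every value of the substitution (plugin) is a term. [folklore] -/
theorem isMvTerm_xySubst (d r : ℕ) (x : Fin d ⊕ Fin r) : IsMvTerm (xySubst d r x) := by
  cases x with
  | inl j => exact isMvTerm_X_pow _ _
  | inr l => exact isMvTerm_X_pow _ _

/-! ### Step 3 of the printed proof: depth-four reduction and the substitution -/

/-- **Sum-of-products-of-sparse form under `PER ∈ VP_ℂ`** (KPTT 2015, §3, the paragraph "By
Theorem 2, … the polynomials `h_n` are computable by depth 4 circuits of size `n^{O(√n log n)}` with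
multiplication gates of fan-in `O(√n)`. Using (plugin), we can plug in powers of `X`, `Y` … to
express `f_n` as a sum of products"): if `L(PER_n) = n^{O(1)}` over `ℂ` and `h_n` is a multilinear
projection of `PER_{q(n)}` in `d + r ≤ 2d` variables (`q, d` p-bounded), then
`h_n(X^{2^j}; Y^{2^l}) = ∑_{i ≤ k} ∏_{j ≤ m} g_{ij}` with `k, t ≤ (n+2)^{C(⌊√d⌋+1)}`,
`m ≤ C(⌊√d⌋+1)`, every `g_{ij}` `t`-sparse. The proof is the tree's proof of Tavenas' Prop. 3.21
(`exists_sps_of_isProjection_perPoly`), verbatim but for the substitution and the size bound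
`L(h_n) ≤ L(PER_{q(n)})` (projections are free, `IsProjection.complexity_le_holds`).
[cite: KoiranPortierTavenasThomasse2015, §3 (proof of Thm. 1); Tavenas2014, Prop. 3.21] -/
theorem exists_sps_xy_of_isProjection_perPoly
    (hτ : IsPBounded fun n => complexity (perPoly (Fin n) ℂ))
    (d r : ℕ → ℕ) (hd : IsPBounded d) (hrd : ∀ n, r n ≤ d n)
    (q : ℕ → ℕ) (hq : IsPBounded q)
    (h : ∀ n, MvPolynomial (Fin (d n) ⊕ Fin (r n)) ℂ)
    (hproj : ∀ n, IsProjection (h n) (perPoly (Fin (q n)) ℂ))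
    (hml : ∀ n, ∀ m ∈ (h n).support, ∀ x, m x ≤ 1) :
    ∃ C : ℕ, ∀ n, ∃ (k m t : ℕ) (g : Fin k → Fin m → MvPolynomial (Fin 2) ℂ),
      k ≤ (n + 2) ^ (C * (Nat.sqrt (d n) + 1)) ∧
      m ≤ C * (Nat.sqrt (d n) + 1) ∧
      t ≤ (n + 2) ^ (C * (Nat.sqrt (d n) + 1)) ∧
      (∀ i j, (g i j).support.card ≤ t) ∧
      (∑ i, ∏ j, g i j) = MvPolynomial.aeval (xySubst (d n) (r n)) (h n) := by
  classical
  -- polynomial bounds as powers of `B = n + 2`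
  obtain ⟨e₁, he₁⟩ := hd.exists_le_pow
  obtain ⟨e₂, he₂⟩ := (IsPBounded.comp_holds hτ hq).exists_le_pow
  refine ⟨prop321Const (e₁ + e₂ + 6), fun n => ?_⟩
  have hB2 : 2 ≤ n + 2 := by omega
  have hD1 : 1 ≤ Nat.sqrt (d n) + 1 := Nat.succ_pos _
  have hu1 : 1 ≤ Nat.sqrt (d n + r n) + 1 := Nat.succ_pos _
  have hδd : d n + r n ≤ 2 * d n := by have := hrd n; omega
  have huD : Nat.sqrt (d n + r n) + 1 ≤ 2 * (Nat.sqrt (d n) + 1) := sqrt_add_one_le hδd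
  have hRle : 8 * (d n + r n) / (Nat.sqrt (d n + r n) + 1 + 1) ≤ 16 * (Nat.sqrt (d n) + 1) :=
    (rounds_le _).trans (by omega)
  -- size of a minimal circuit for `h n` (an opaque name `s`, so that no tactic unfolds `complexity`)
  obtain ⟨s, hs⟩ : ∃ s : ℕ, complexity (h n) = s := ⟨_, rfl⟩
  have hsle : s ≤ (n + 2) ^ e₂ :=
    calc s = complexity (h n) := hs.symm
      _ ≤ complexity (perPoly (Fin (q n)) ℂ) := IsProjection.complexity_le_holds (hproj n)
      _ ≤ (n + 2) ^ e₂ := he₂ n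
  -- the exponent
  obtain ⟨hδ1, hsE, hu1', hδu⟩ := prop321_exponent hB2 (he₁ n) (hrd n) hsle
  -- the sparsity bound of a polynomial of degree `≤ u` in `δ` variables under the substitution (plugin)
  have hsparse : ∀ p : MvPolynomial (Fin (d n) ⊕ Fin (r n)) ℂ, p.totalDegree ≤ Nat.sqrt (d n + r n) + 1 →
      (MvPolynomial.aeval (xySubst (d n) (r n)) p).support.card ≤
        (n + 2) ^ (prop321Const (e₁ + e₂ + 6) * (Nat.sqrt (d n) + 1)) := by
    intro p hp
    calc (MvPolynomial.aeval (xySubst (d n) (r n)) p).support.card ≤ p.support.card :=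
          card_support_aeval_le_of_isMvTerm (isMvTerm_xySubst _ _) p
      _ ≤ (Nat.sqrt (d n + r n) + 1 + 1) *
            (Fintype.card (Fin (d n) ⊕ Fin (r n)) + (Nat.sqrt (d n + r n) + 1)) ^ (Nat.sqrt (d n + r n) + 1) :=
          DepthReduction.card_le_of_degree_le _ hu1 fun m hm => (le_totalDegree hm).trans hp
      _ = (Nat.sqrt (d n + r n) + 1 + 1) *
            (d n + r n + (Nat.sqrt (d n + r n) + 1)) ^ (Nat.sqrt (d n + r n) + 1) := by
          rw [Fintype.card_sum, Fintype.card_fin, Fintype.card_fin]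
      _ ≤ (n + 2) ^ (prop321Const (e₁ + e₂ + 6) * (Nat.sqrt (d n) + 1)) := prop321_tBound hB2 hD1 hu1' hδu huD
  -- a minimal circuit for `h n` and its straight-line program
  obtain ⟨P, hP1, hP2, hP3⟩ := exists_computes_size_eq_complexity (h n)
  obtain ⟨S, hSlen, hcases⟩ := DepthReduction.exists_slp P hP1
  rw [show P.eval = h n from hP2] at hcases
  rw [hs] at hP3
  rcases hcases with ⟨i, hi, hval⟩ | htriv
  · -- main case: `h n` is a value of the straight-line program
    have hdegh : (S.val i).totalDegree ≤ d n + r n := by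
      rw [← hval]
      have := totalDegree_le_card_of_multilinear (hml n)
      rwa [Fintype.card_sum, Fintype.card_fin, Fintype.card_fin] at this
    obtain ⟨L, hLsum, hLlen, hLT⟩ := S.exists_sum_prod (d n + r n) (t := Nat.sqrt (d n + r n) + 1) hu1 hi hdegh
    rw [hSlen, hP3] at hLlen
    refine ⟨L.length, 1 + 4 * (8 * (d n + r n) / (Nat.sqrt (d n + r n) + 1 + 1)),
      (n + 2) ^ (prop321Const (e₁ + e₂ + 6) * (Nat.sqrt (d n) + 1)),
      fun i j => MvPolynomial.aeval (xySubst (d n) (r n)) ((L[i.val]).getD j.val 1),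
      hLlen.trans (prop321_kBound hB2 hD1 hδ1 hsE hRle), prop321_mBound hD1 hRle, le_rfl, ?_, ?_⟩
    · -- sparsity of the factors
      intro i j
      apply hsparse
      rcases DepthReduction.getD_one_mem_or (L[i.val]) j.val with hmem | hone
      · exact (hLT _ (List.getElem_mem _)).2 _ hmem
      · rw [hone, totalDegree_one]; exact Nat.zero_le _
    · -- the identity `∑ ∏ g i j = h_n(X^{2^j}; Y^{2^l})`
      rw [hval, ← hLsum]
      have hprod : ∀ i : Fin L.length,
          ∏ j : Fin (1 + 4 * (8 * (d n + r n) / (Nat.sqrt (d n + r n) + 1 + 1))),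
              MvPolynomial.aeval (xySubst (d n) (r n)) ((L[i.val]).getD j.val 1) =
            MvPolynomial.aeval (xySubst (d n) (r n)) (L[i.val]).prod := fun i => by
        rw [← map_prod, DepthReduction.prod_getD_one _ _ (hLT _ (List.getElem_mem _)).1]
      simp only [hprod]
      rw [map_list_sum, List.map_map]
      exact Fin.sum_univ_fun_getElem L (fun l => MvPolynomial.aeval (xySubst (d n) (r n)) l.prod)
  · -- degenerate case: `h n` is a variable or a constant, a single term
    have hterm : IsMvTerm (MvPolynomial.aeval (xySubst (d n) (r n)) (h n)) := by
      rcases htriv with ⟨j, hj⟩ | ⟨c, hc⟩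
      · rw [hj, MvPolynomial.aeval_X]; exact isMvTerm_xySubst _ _ j
      · rw [hc, MvPolynomial.aeval_C, MvPolynomial.algebraMap_eq]; exact isMvTerm_C c
    have h1 : 1 ≤ (n + 2) ^ (prop321Const (e₁ + e₂ + 6) * (Nat.sqrt (d n) + 1)) :=
      Nat.one_le_pow _ _ (by omega)
    refine ⟨1, 1, 1, fun _ _ => MvPolynomial.aeval (xySubst (d n) (r n)) (h n), h1,
      one_le_prop321Const_mul hD1, h1, fun _ _ => hterm.card_support_le, ?_⟩
    simp

/-! ### Step 2 of the printed proof over `ℂ`: `h_n` is a projection of a p-bounded permanent -/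

namespace TavenasVn

open DefVNP ArithExpr BoolGadgets Complexity.ArithCkt

/-- The Valiant-criterion witness of `h_n` over `ℂ`, with its Boolean block renamed to
`Fin (n + s)` (the library's `boolSum` form). [cite: Tavenas2014, proof of Prop. 3.17] -/
def witnessFinC (n : ℕ) : ArithExpr ℂ (XZ n ⊕ Fin (n + (vCirc n).size)) :=
  (witnessE ℂ n).rename (Sum.map id finSumFinEquiv)

/-- Its Boolean sum is `h_n` over `ℂ` (Valiant's criterion as an identity,
`bsum_eval_witnessE`). [cite: Tavenas2014, Prop. 3.10 and proof of Prop. 3.17] -/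
theorem boolSum_witnessFinC (n : ℕ) : boolSum (witnessFinC n).eval = hV ℂ n := by
  rw [witnessFinC, ArithExpr.eval_rename, boolSum_rename_equiv, bsum_eval_witnessE]

/-- The size of the witness over `ℂ` is p-bounded (same count as over `ℚ`,
`size_witnessE_le`). [folklore] -/
theorem isPBounded_size_witnessFinC : IsPBounded fun n => (witnessFinC n).size := by
  have c := fun m : ℕ => IsPBounded.const m
  have hstep : IsPBounded mulStepSize := by
    unfold mulStepSize addSize
    exact IsPBounded.add_holds (IsPBounded.add_holds IsPBounded.id IsPBounded.id)
      (IsPBounded.add_holds (IsPBounded.mul_holds (c 73) (IsPBounded.add_holds IsPBounded.id IsPBounded.id)) (c 1))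
  have hsz : IsPBounded vExpSize := by
    unfold vExpSize
    exact IsPBounded.add_holds (IsPBounded.add_holds IsPBounded.id
      (IsPBounded.add_holds (IsPBounded.mul_holds IsPBounded.id hstep) (c 1))) (c 1)
  have hR : IsPBounded R := IsPBounded.add_holds (IsPBounded.mul_holds (c 2) IsPBounded.id) (c 3)
  refine (IsPBounded.add_holds (IsPBounded.add_holds (IsPBounded.add_holds (IsPBounded.mul_holds (c 54) hsz)
    (IsPBounded.mul_holds (c 4) IsPBounded.id)) (IsPBounded.mul_holds (c 4) hR)) (c 2)).mono fun n => ?_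
  rw [witnessFinC, ArithExpr.size_rename]
  exact size_witnessE_le ℂ n

/-- **`h_n` is a projection of `PER_{q(n)}` over `ℂ`, `q` p-bounded** (print: "By Valiant's
criterion … `(h_n) ∈ VNP`. Since the permanent is `VNP`-complete …"; here through the explicit
expression `W_n` and BCS Thm. (21.27), Thm. (21.29) over `ℂ`, `isProjection_boolSum_eval`).
[cite: KoiranPortierTavenasThomasse2015, §3 (proof of Thm. 1); BurgisserClausenShokrollahi1997, Thm. (21.29)] -/
theorem exists_isProjection_hV_perPoly_complex :
    ∃ q : ℕ → ℕ, IsPBounded q ∧ ∀ n, IsProjection (hV ℂ n) (perPoly (Fin (q n)) ℂ) := by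
  have hchar : ringChar ℂ ≠ 2 := by rw [ringChar.eq_zero]; norm_num
  choose N hN hproj using fun n =>
    isProjection_boolSum_eval (BCS1997_thm_21_27_holds ℂ) (BCS1997_thm_21_29_holds ℂ) hchar (witnessFinC n)
  refine ⟨N, ?_, fun n => ?_⟩
  · have c := fun m : ℕ => IsPBounded.const m
    exact (IsPBounded.mul_holds (c 10) (IsPBounded.add_holds (IsPBounded.mul_holds (c 2) isPBounded_size_witnessFinC)
      (c 2))).mono hN
  · rw [← boolSum_witnessFinC]
    exact hproj n

end TavenasVn

/-! ### Step 1 of the printed proof: the witness `F_n` and its Newton polygon -/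

namespace KPTT

open TavenasVn BoolGadgets Complexity.ArithCkt

/-- The exponent vector `(i, 2i(2^n-1-i))` of the `i`-th monomial of `F_n`. [cite: KoiranPortierTavenasThomasse2015, §3 (hardpoly), variant] -/
def kpttExp (n i : ℕ) : Fin 2 →₀ ℕ := Finsupp.single 0 i + Finsupp.single 1 (vExp n i)

/-- **The witness** `F_n(X, Y) = ∑_{i<2^n} X^i Y^{2i(2^n-1-i)} ∈ ℂ[X, Y]` (the paper's
`f_n = ∑ X^i Y^{i²}` with the parabola `i ↦ i²` replaced by the parabola `i ↦ 2i(2^n-1-i)` of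
Tavenas' `V_n`; either has all its `2^n` support points in strictly convex position). [cite: KoiranPortierTavenasThomasse2015, §3 (hardpoly), variant] -/
def kpttPoly (n : ℕ) : MvPolynomial (Fin 2) ℂ :=
  ∑ i ∈ Finset.range (2 ^ n), monomial (kpttExp n i) 1

/-- First coordinate of the `i`-th exponent vector: the `X`-degree `i`. [folklore] -/
@[simp] theorem kpttExp_zero (n i : ℕ) : kpttExp n i 0 = i := by
  simp [kpttExp]

/-- Second coordinate of the `i`-th exponent vector: the `Y`-degree `2i(2^n-1-i)`. [folklore] -/
@[simp] theorem kpttExp_one (n i : ℕ) : kpttExp n i 1 = vExp n i := by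
  simp [kpttExp]

/-- The exponent vectors are pairwise distinct (first coordinate). [folklore] -/
theorem kpttExp_injective (n : ℕ) : Function.Injective (kpttExp n) := fun i j h => by
  have := congrArg (fun m => m 0) h
  simpa using this

/-- The support of `F_n` is `{(i, 2i(2^n-1-i)) : i < 2^n}`. [cite: KoiranPortierTavenasThomasse2015, §3] -/
theorem support_kpttPoly (n : ℕ) : (kpttPoly n).support = (Finset.range (2 ^ n)).image (kpttExp n) := by
  classical
  ext m
  rw [mem_support_iff, kpttPoly, coeff_sum]
  simp only [coeff_monomial]
  constructor
  · intro h
    obtain ⟨i, hi, hne⟩ := Finset.exists_ne_zero_of_sum_ne_zero h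
    rw [Finset.mem_image]
    refine ⟨i, hi, ?_⟩
    by_contra hmi
    exact hne (if_neg hmi)
  · intro h
    obtain ⟨i, hi, rfl⟩ := Finset.mem_image.1 h
    rw [Finset.sum_eq_single i]
    · simp
    · intro j _ hji
      exact if_neg fun h => hji (kpttExp_injective n h)
    · intro hi'
      exact absurd hi hi'

/-! #### The substitution (plugin) applied to `h_n` gives `F_n` -/

/-- The `x`-monomial under (plugin) is `X^i`. [cite: KoiranPortierTavenasThomasse2015, §3 (plugin)] -/
theorem aeval_xySubst_xselV (n : ℕ) (e : Fin n → Bool) :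
    aeval (xySubst (R n) (R n)) (xselV ℂ n e) = (X 0 : MvPolynomial (Fin 2) ℂ) ^ Nat.ofBits e := by
  unfold xselV
  rw [ofBits_eq_sum, map_prod]
  have h : ∀ i : Fin n, aeval (xySubst (R n) (R n)) (if e i then (X (Sum.inl (xIdx i)) : MvPolynomial (XZ n) ℂ) else 1) =
      (X 0 : MvPolynomial (Fin 2) ℂ) ^ ((e i).toNat * 2 ^ (i : ℕ)) := by
    intro i
    cases e i
    · simp
    · simp [xySubst, xIdx]
  simp only [h]
  exact Finset.prod_pow_eq_pow_sum _ _ _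

/-- The `y`-monomial under (plugin) is `Y^{ofBits c}`. [cite: KoiranPortierTavenasThomasse2015, §3 (plugin)] -/
theorem aeval_xySubst_zselV (n : ℕ) (c : Fin (R n) → Bool) :
    aeval (xySubst (R n) (R n)) (zselV ℂ n c) = (X 1 : MvPolynomial (Fin 2) ℂ) ^ Nat.ofBits c := by
  unfold zselV
  rw [ofBits_eq_sum, map_prod]
  have h : ∀ l : Fin (R n), aeval (xySubst (R n) (R n)) (if c l then (X (Sum.inr l) : MvPolynomial (XZ n) ℂ) else 1) =
      (X 1 : MvPolynomial (Fin 2) ℂ) ^ ((c l).toNat * 2 ^ (l : ℕ)) := by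
    intro l
    cases c l
    · simp
    · simp [xySubst]
  simp only [h]
  exact Finset.prod_pow_eq_pow_sum _ _ _

/-- **Display (plugin) for `F_n`**: `h_n(X^{2^0}, …, X^{2^{2n+2}}, Y^{2^0}, …, Y^{2^{2n+2}}) = F_n`. [cite: KoiranPortierTavenasThomasse2015, §3 (plugin)] -/
theorem aeval_xySubst_hV (n : ℕ) : aeval (xySubst (R n) (R n)) (hV ℂ n) = kpttPoly n := by
  unfold hV
  rw [map_sum]
  have h1 : ∀ e : Fin n → Bool, aeval (xySubst (R n) (R n)) (xselV ℂ n e * zselV ℂ n (vExpBits n (R n) e)) =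
      (X 0 : MvPolynomial (Fin 2) ℂ) ^ Nat.ofBits e * X 1 ^ vExp n (Nat.ofBits e) := by
    intro e
    rw [map_mul, aeval_xySubst_xselV, aeval_xySubst_zselV]
    congr 2
    rw [vExpBits, ofBits_bitsOf, Nat.mod_eq_of_lt (vExp_lt_two_pow_R n e)]
  simp only [h1]
  rw [sum_boolVec_eq_sum_range (fun i => (X 0 : MvPolynomial (Fin 2) ℂ) ^ i * X 1 ^ vExp n i)]
  unfold kpttPoly
  refine Finset.sum_congr rfl fun i _ => ?_
  rw [X_pow_eq_monomial, X_pow_eq_monomial, monomial_mul, mul_one]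
  rfl

/-! #### All `2^n` support points are vertices of the Newton polygon -/

/-- **A strictly exposed point of a finite configuration is a vertex of its convex hull**: if a
linear functional `l` is strictly larger at `p ∈ S` than on `S ∖ {p}`, then `p` is an extreme point
of `conv(S)`. (The set `{p} ∪ {l < l p}` is convex and contains `S`, hence `conv(S)`; an open
segment through `p` inside it must be constant.) [folklore] -/
theorem convexHull_subset_insert_halfSpace {E : Type*} [AddCommGroup E] [Module ℝ E]
    {S : Set E} {p : E} (l : E →ₗ[ℝ] ℝ) (hl : ∀ q ∈ S, q ≠ p → l q < l p) :
    convexHull ℝ S ⊆ {q | q = p ∨ l q < l p} := by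
  refine convexHull_min (fun q hq => ?_) ?_
  · by_cases hqp : q = p
    · exact Or.inl hqp
    · exact Or.inr (hl q hq hqp)
  · intro x hx y hy a b ha hb hab
    simp only [Set.mem_setOf_eq] at hx hy ⊢
    have hy' : l y ≤ l p := by
      rcases hy with hyp | hy
      · rw [hyp]
      · exact hy.le
    have hab' : a * l p + b * l p = l p := by rw [← add_mul, hab, one_mul]
    rcases ha.eq_or_lt with ha0 | ha'
    · subst ha0
      rw [zero_add] at hab
      subst hab
      rw [zero_smul, zero_add, one_smul]
      exact hy
    rcases hb.eq_or_lt with hb0 | hb'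
    · subst hb0
      rw [add_zero] at hab
      subst hab
      rw [zero_smul, add_zero, one_smul]
      exact hx
    rcases hx with hxp | hx
    · rcases hy with hyp | hy
      · left
        rw [hxp, hyp, ← add_smul, hab, one_smul]
      · right
        rw [map_add, map_smul, map_smul, smul_eq_mul, smul_eq_mul, hxp]
        have h1 := mul_pos hb' (sub_pos.2 hy)
        linarith
    · right
      rw [map_add, map_smul, map_smul, smul_eq_mul, smul_eq_mul]
      have h1 := mul_pos ha' (sub_pos.2 hx)
      have h2 := mul_nonneg hb (sub_nonneg.2 hy')
      linarith

/-- A strictly exposed point of `S` is an extreme point of `conv(S)`. [folklore] -/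
theorem mem_extremePoints_convexHull_of_linear {E : Type*} [AddCommGroup E] [Module ℝ E]
    {S : Set E} {p : E} (hp : p ∈ S) (l : E →ₗ[ℝ] ℝ) (hl : ∀ q ∈ S, q ≠ p → l q < l p) :
    p ∈ (convexHull ℝ S).extremePoints ℝ := by
  have hT := convexHull_subset_insert_halfSpace l hl
  rw [mem_extremePoints]
  refine ⟨subset_convexHull ℝ S hp, fun x₁ hx₁ x₂ hx₂ hseg => ?_⟩
  obtain ⟨a, b, ha, hb, hab, hx⟩ := hseg
  have e := congrArg l hx
  rw [map_add, map_smul, map_smul, smul_eq_mul, smul_eq_mul] at e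
  have hab' : a * l p + b * l p = l p := by rw [← add_mul, hab, one_mul]
  rcases hT hx₁ with h₁ | h₁ <;> rcases hT hx₂ with h₂ | h₂
  · exact ⟨h₁, h₂⟩
  · exfalso
    rw [h₁] at e
    have := mul_pos hb (sub_pos.2 h₂)
    linarith
  · exfalso
    rw [h₂] at e
    have := mul_pos ha (sub_pos.2 h₁)
    linarith
  · exfalso
    have := mul_pos ha (sub_pos.2 h₁)
    have := mul_pos hb (sub_pos.2 h₂)
    linarith

/-- If every point of `S ⊆ ℝ²` is strictly exposed then the vertices of `conv(S)` are exactly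
the points of `S`. [folklore] -/
theorem extremePoints_convexHull_eq_of_linear {S : Set (Fin 2 → ℝ)} (l : (Fin 2 → ℝ) → (Fin 2 → ℝ) →ₗ[ℝ] ℝ)
    (hl : ∀ p ∈ S, ∀ q ∈ S, q ≠ p → l p q < l p p) :
    (convexHull ℝ S).extremePoints ℝ = S :=
  Set.Subset.antisymm extremePoints_convexHull_subset fun p hp =>
    mem_extremePoints_convexHull_of_linear hp (l p) (hl p hp)

/-- The lattice point of a monomial of `ℂ[X, Y]`, as in `newtonVertexCount`. [cite: KoiranPortierTavenasThomasse2015, §2] -/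
def toPt (e : Fin 2 →₀ ℕ) : Fin 2 → ℝ := fun i => ((e i : ℕ) : ℝ)

/-- The `i`-th support point `(i, 2i(2^n-1-i))` of `F_n`. [cite: KoiranPortierTavenasThomasse2015, §3] -/
def kpttPt (n i : ℕ) : Fin 2 → ℝ := toPt (kpttExp n i)

/-- First coordinate of the `i`-th support point. [folklore] -/
@[simp] theorem kpttPt_zero (n i : ℕ) : kpttPt n i 0 = i := by simp [kpttPt, toPt]

/-- Second coordinate of the `i`-th support point. [folklore] -/
@[simp] theorem kpttPt_one (n i : ℕ) : kpttPt n i 1 = vExp n i := by simp [kpttPt, toPt]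

/-- The support points are pairwise distinct. [folklore] -/
theorem kpttPt_injective (n : ℕ) : Function.Injective (kpttPt n) := fun i j h => by
  have := congrArg (fun q => q 0) h
  simpa using this

/-- The separating functional at the point `p = (i, ·)`: `(x, y) ↦ y + (4i - 2(2^n-1)) x`, the
tangent direction of the concave parabola `y = 2x(2^n-1-x)` at `x = i`. [folklore] -/
def sepFun (n : ℕ) (p : Fin 2 → ℝ) : (Fin 2 → ℝ) →ₗ[ℝ] ℝ :=
  LinearMap.proj 1 + (4 * p 0 - 2 * ((2 ^ n - 1 : ℕ) : ℝ)) • LinearMap.proj 0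

/-- The separating functional, evaluated. [folklore] -/
@[simp] theorem sepFun_apply (n : ℕ) (p q : Fin 2 → ℝ) :
    sepFun n p q = q 1 + (4 * p 0 - 2 * ((2 ^ n - 1 : ℕ) : ℝ)) * q 0 := by
  simp [sepFun]

/-- **Strict concavity**: the functional of the `i`-th point is strictly maximal there,
`ℓ_i(P_j) < ℓ_i(P_i)` for `j ≠ i` (the difference is `2(i-j)²`). [folklore] -/
theorem sepFun_lt (n : ℕ) {i j : ℕ} (hi : i < 2 ^ n) (hj : j < 2 ^ n) (hij : j ≠ i) :
    sepFun n (kpttPt n i) (kpttPt n j) < sepFun n (kpttPt n i) (kpttPt n i) := by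
  simp only [sepFun_apply, kpttPt_zero, kpttPt_one]
  set N : ℕ := 2 ^ n - 1 with hN
  have hiN : i ≤ N := by omega
  have hjN : j ≤ N := by omega
  -- `vExp n x = 2 x (N - x)` with `x + (N - x) = N`
  have hM : ((j : ℝ) + ((N - j : ℕ) : ℝ)) = N := by exact_mod_cast Nat.add_sub_cancel' hjN
  have hM' : ((i : ℝ) + ((N - i : ℕ) : ℝ)) = N := by exact_mod_cast Nat.add_sub_cancel' hiN
  have hvj : ((vExp n j : ℕ) : ℝ) = 2 * (j * ((N - j : ℕ) : ℝ)) := by unfold vExp; push_cast; ring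
  have hvi : ((vExp n i : ℕ) : ℝ) = 2 * (i * ((N - i : ℕ) : ℝ)) := by unfold vExp; push_cast; ring
  rw [hvj, hvi]
  have hne : (i : ℝ) - j ≠ 0 := sub_ne_zero.2 (fun h => hij (Nat.cast_injective h).symm)
  have hsq : 0 < ((i : ℝ) - j) ^ 2 := lt_of_le_of_ne (sq_nonneg _) (Ne.symm (pow_ne_zero 2 hne))
  have key : (2 * (i * ((N - i : ℕ) : ℝ)) + (4 * (i : ℝ) - 2 * N) * i) -
      (2 * (j * ((N - j : ℕ) : ℝ)) + (4 * (i : ℝ) - 2 * N) * j) = 2 * ((i : ℝ) - j) ^ 2 := by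
    linear_combination (2 * (i : ℝ)) * hM' - (2 * (j : ℝ)) * hM
  linarith

/-- **The Newton polygon of `F_n` has exactly `2^n` vertices** (print: "The Newton polygon of
`f_n` has exactly `2^n` edges"). [cite: KoiranPortierTavenasThomasse2015, §3] -/
theorem newtonVertexCount_kpttPoly (n : ℕ) : newtonVertexCount (kpttPoly n) = 2 ^ n := by
  classical
  have hS : ((fun e : Fin 2 →₀ ℕ => fun i : Fin 2 => ((e i : ℕ) : ℝ)) '' ((kpttPoly n).support : Set (Fin 2 →₀ ℕ))) =
      kpttPt n '' (Finset.range (2 ^ n) : Set ℕ) := by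
    rw [support_kpttPoly, Finset.coe_image, Set.image_image]
    rfl
  have hext : (convexHull ℝ (kpttPt n '' (Finset.range (2 ^ n) : Set ℕ))).extremePoints ℝ =
      kpttPt n '' (Finset.range (2 ^ n) : Set ℕ) := by
    refine extremePoints_convexHull_eq_of_linear (sepFun n) ?_
    rintro p ⟨i, hi, rfl⟩ q ⟨j, hj, rfl⟩ hne
    exact sepFun_lt n (Finset.mem_coe.1 hi |> Finset.mem_range.1) (Finset.mem_coe.1 hj |> Finset.mem_range.1)
      (fun h => hne (by rw [h]))
  show (Set.extremePoints ℝ (convexHull ℝ ((fun e : Fin 2 →₀ ℕ => fun i : Fin 2 => ((e i : ℕ) : ℝ)) ''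
    ((kpttPoly n).support : Set (Fin 2 →₀ ℕ))))).ncard = 2 ^ n
  rw [hS, hext, Set.ncard_image_of_injective _ (kpttPt_injective n), Set.ncard_coe_finset,
    Finset.card_range]

/-! ### Theorem 1 -/

/-- **Discharge of KPTT 2015, Theorem 1 (weak form)**: the weak Newton-polygon τ-conjecture
`#vert Newt(∑_{i<k} ∏_{j<m} f_ij) ≤ 2^{am} (kt+2)^b` implies that the permanent family is not in
`VP_ℂ`. Printed proof, §3: assuming `PER ∈ VP_ℂ`, the bit polynomial `h_n` of the witness is a
projection of a p-bounded permanent (Valiant's criterion + `VNP`-completeness), hence has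
polynomial-size circuits; reduction to depth four and the substitution (plugin) write the witness
as `∑_{i≤k} ∏_{j≤m} g_{ij}` with `k, t = n^{O(√n)}`, `m = O(√n)`; the weak bound then gives
`2^n ≤ 2^{O(√n)} n^{O(√n)}`, absurd for large `n`. [cite: KoiranPortierTavenasThomasse2015, Thm. 1] -/
theorem theorem1_holds : theorem1 := by
  intro hW hVP
  obtain ⟨a, b, hab⟩ := hW
  -- Step 2: `h_n` is a projection of `PER_{q(n)}` over `ℂ`
  obtain ⟨q, hq, hproj⟩ := exists_isProjection_hV_perPoly_complex
  -- `PER ∈ VP_ℂ`: `L(PER_n) = n^{O(1)}`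
  have hτ : IsPBounded fun n => complexity (perPoly (Fin n) ℂ) := hVP.2
  -- Step 3: the sum-of-products-of-sparse form of `F_n`
  have hdP : IsPBounded (fun n => 2 * n + 3) :=
    (IsPBounded.iff_exists_le_mul_succ_pow _).2 ⟨3, 1, fun n => by rw [pow_one]; omega⟩
  obtain ⟨C, hC⟩ := exists_sps_xy_of_isProjection_perPoly hτ (fun n => 2 * n + 3) (fun n => 2 * n + 3) hdP
    (fun n => le_rfl) q hq (fun n => hV ℂ n) hproj (fun n => hV_multilinear n)
  -- Step 4: the bad `n`
  obtain ⟨n, hn⟩ := exists_pow_sqrt_lt_two_pow ((a + 2 * b) * C + 2 * b)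
  obtain ⟨k, m, t, g, hk, hm, ht, hg, hsum⟩ := hC n
  have hcount := hab k m t g hg
  rw [hsum, show MvPolynomial.aeval (xySubst (2 * n + 3) (2 * n + 3)) (hV ℂ n) = kpttPoly n from
    aeval_xySubst_hV n, newtonVertexCount_kpttPoly] at hcount
  -- `2^(a m) (k t + 2)^b ≤ (n + 2)^{K (s + 4)}` with `s = ⌊√(2n+3)⌋`, `E = C (s + 1)`
  set s : ℕ := Nat.sqrt (2 * n + 3) with hs
  set E : ℕ := C * (s + 1) with hE
  have hB2 : 2 ≤ n + 2 := by omega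
  have h1E : 1 ≤ (n + 2) ^ E := Nat.one_le_pow _ _ (by omega)
  have h2am : 2 ^ (a * m) ≤ (n + 2) ^ (a * E) :=
    calc 2 ^ (a * m) ≤ (n + 2) ^ (a * m) := Nat.pow_le_pow_left hB2 _
      _ ≤ (n + 2) ^ (a * E) := Nat.pow_le_pow_right (by omega) (Nat.mul_le_mul_left a hm)
  have hkt : k * t + 2 ≤ (n + 2) ^ (2 * E + 2) := by
    have h4 : 4 ≤ (n + 2) ^ 2 := by
      calc 4 = 2 ^ 2 := by norm_num
        _ ≤ (n + 2) ^ 2 := Nat.pow_le_pow_left hB2 2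
    have hkt' : k * t ≤ (n + 2) ^ (2 * E) :=
      calc k * t ≤ (n + 2) ^ E * (n + 2) ^ E := Nat.mul_le_mul hk ht
        _ = (n + 2) ^ (2 * E) := by rw [← pow_add, two_mul]
    have h1' : 1 ≤ (n + 2) ^ (2 * E) := Nat.one_le_pow _ _ (by omega)
    calc k * t + 2 ≤ (n + 2) ^ (2 * E) * 4 := by omega
      _ ≤ (n + 2) ^ (2 * E) * (n + 2) ^ 2 := Nat.mul_le_mul_left _ h4
      _ = (n + 2) ^ (2 * E + 2) := by rw [← pow_add]
  have hbound : 2 ^ (a * m) * (k * t + 2) ^ b ≤ (n + 2) ^ (a * E + (2 * E + 2) * b) :=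
    calc 2 ^ (a * m) * (k * t + 2) ^ b ≤ (n + 2) ^ (a * E) * ((n + 2) ^ (2 * E + 2)) ^ b :=
          Nat.mul_le_mul h2am (Nat.pow_le_pow_left hkt b)
      _ = (n + 2) ^ (a * E + (2 * E + 2) * b) := by rw [← pow_mul, ← pow_add]
  have hexp : a * E + (2 * E + 2) * b ≤ ((a + 2 * b) * C + 2 * b) * (s + 4) := by
    rw [hE]; nlinarith
  have key : 2 ^ n ≤ (n + 2) ^ (((a + 2 * b) * C + 2 * b) * (s + 4)) :=
    calc 2 ^ n ≤ 2 ^ (a * m) * (k * t + 2) ^ b := hcount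
      _ ≤ (n + 2) ^ (a * E + (2 * E + 2) * b) := hbound
      _ ≤ (n + 2) ^ (((a + 2 * b) * C + 2 * b) * (s + 4)) := Nat.pow_le_pow_right (by omega) hexp
  exact absurd key (not_le.2 hn)

end KPTT

end Literature.Computability.AlgebraicComplexity
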